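import Literature.MathematicalPhysics.QuantumManyBody.GroundStateFeynmanKacFormUpper
import Literature.MathematicalPhysics.QuantumManyBody.GroundStateFeynmanKacInteraction
import HarnessLib

/-!
# Route BECCutLineWeakDisorder — `WitnessTransfer`, form bound I:
# translation errors without continuity

Support file (does not close the item) for item stmt-AtomisticToContinuum-14978
(`Summit.AtomisticToContinuum.BoseEinsteinCondensation.Theses.BECCutLineWeakDisorder`, decl
`WitnessTransfer`), stub `stub_formBound` (E1a) of line `Sketch`: the small-time form bound of
a merely measurable, bounded `Ψ ≥ 0` vanishing off the box `Λ_L^N`, for a general measurable pair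
potential `v : ℝ → [0, ∞]`. The library's `tendsto_interactionTerm_div` controls the
`L¹`-translation errors `E ∫ |Ψ(y + d(ω)) − Ψ(y)| dy` of `interactionSlice_le` by uniform
continuity of `Ψ`; here they are
controlled by the Gaussian increment `sqIncr` instead (which the eigen-inequality makes small):

* `lintegral_enorm_translate_sub_le_eta` — for `Ψ` vanishing off the box, every shift `d` and
  `η > 0`: `∫ |Ψ(y + d) − Ψ(y)| dy ≤ η ∫ (Ψ(y + d) − Ψ(y))² dy + η⁻¹ · 2|Λ_L^N|` (the integrand
  lives on `Λ ∪ (Λ − d)` and `|g| ≤ η g² + η⁻¹`);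
* `lintegral_lintegral_enorm_translate_le_sqIncr` — the random version along `d = √2 b_s`:
  `E ∫ |Ψ(y + c_s) − Ψ(y)| dy ≤ η · sqIncr s Ψ + η⁻¹ · 2|Λ_L^N|`;
* `translate_errors_le_three_mul` — the two error terms of `interactionSlice_le` (shifts `−c_s` and
  `c_t − c_s`) are at most `3 (η S + η⁻¹ · 2|Λ_L^N|)` whenever `sqIncr s Ψ, sqIncr t Ψ ≤ S`;
* truncation bookkeeping for `min v k`: `interaction_mono_profile`, `pathAction_mono_profile`,
  `pathAction_le_one_sub_fkWeight_add_sq_of_le` (`∫₀ᵗ(V∧k) ≤ (1 − w_t) + (∫₀ᵗ(V∧k))²`, no killing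
  term), `monotone_interaction_min`, `tendsto_interaction_min`.

## References

* K. L. Chung, Z. Zhao, *From Brownian Motion to Schrödinger's Equation* (1995), Prop 3.29.
  [ChungZhao1995]
-/

noncomputable section

open MeasureTheory Filter Set Metric
open scoped ENNReal NNReal Topology

namespace Summit.AtomisticToContinuum.BoseEinsteinCondensation.Theorems.CutLineWitness

open Literature.MathematicalPhysics.QuantumManyBody.BoseGas

variable {N : ℕ}

/-! ### `L¹`-translation errors controlled by squared increments -/

/-- `|g| ≤ η g² + η⁻¹` for `η > 0`. [folklore] -/
theorem abs_le_eta_mul_sq_add_inv {η : ℝ} (hη : 0 < η) (g : ℝ) : |g| ≤ η * g ^ 2 + η⁻¹ := by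
  have h1 : η * |g| ≤ η ^ 2 * g ^ 2 + 1 := by
    nlinarith [sq_nonneg (η * |g| - 1), sq_abs g, abs_nonneg g]
  calc |g| = η * |g| / η := by field_simp
    _ ≤ (η ^ 2 * g ^ 2 + 1) / η := div_le_div_of_nonneg_right h1 hη.le
    _ = η * g ^ 2 + η⁻¹ := by field_simp

/-- **`L¹`-translation error of a function vanishing off the box, by its `L²`-translation error**:
`∫ |f(y + d) − f(y)| dy ≤ η ∫ (f(y + d) − f(y))² dy + η⁻¹ · 2|Λ_L^N|` for every `η > 0` (the
integrand vanishes unless `y ∈ Λ` or `y + d ∈ Λ`, a set of measure `≤ 2|Λ|`). [folklore] -/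
theorem lintegral_enorm_translate_sub_le_eta {L : ℝ} {f : Config N → ℝ} (hf : Measurable f)
    (h0 : ∀ X, X ∉ boxN N L → f X = 0) (d : Config N) {η : ℝ} (hη : 0 < η) :
    ∫⁻ y, ‖f (y + d) - f y‖ₑ ≤ ENNReal.ofReal η * (∫⁻ y, ENNReal.ofReal ((f (y + d) - f y) ^ 2)) +
      (ENNReal.ofReal η)⁻¹ * (2 * volume (boxN N L)) := by
  set S : Set (Config N) := boxN N L ∪ (fun y => y + d) ⁻¹' boxN N L with hS
  have hSm : MeasurableSet S :=
    (measurableSet_boxN N L).union ((measurableSet_boxN N L).preimage (measurable_add_const d))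
  have hpt : ∀ y, ‖f (y + d) - f y‖ₑ ≤ ENNReal.ofReal η * ENNReal.ofReal ((f (y + d) - f y) ^ 2) +
      S.indicator (fun _ => (ENNReal.ofReal η)⁻¹) y := by
    intro y
    by_cases hy : y ∈ S
    · rw [indicator_of_mem hy, Real.enorm_eq_ofReal_abs, ← ENNReal.ofReal_inv_of_pos hη,
        ← ENNReal.ofReal_mul hη.le, ← ENNReal.ofReal_add (by positivity) (by positivity)]
      exact ENNReal.ofReal_le_ofReal (abs_le_eta_mul_sq_add_inv hη _)
    · have hy1 : y ∉ boxN N L := fun h' => hy (Or.inl h')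
      have hy2 : y + d ∉ boxN N L := fun h' => hy (Or.inr h')
      rw [h0 _ hy1, h0 _ hy2, sub_zero, enorm_zero]
      exact bot_le
  have hm2 : Measurable fun y => ENNReal.ofReal η * ENNReal.ofReal ((f (y + d) - f y) ^ 2) :=
    (ENNReal.measurable_ofReal.comp
      (((hf.comp (measurable_add_const d)).sub hf).pow_const 2)).const_mul _
  calc ∫⁻ y, ‖f (y + d) - f y‖ₑ
      ≤ ∫⁻ y, (ENNReal.ofReal η * ENNReal.ofReal ((f (y + d) - f y) ^ 2) +
          S.indicator (fun _ => (ENNReal.ofReal η)⁻¹) y) := lintegral_mono hpt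
    _ = ENNReal.ofReal η * (∫⁻ y, ENNReal.ofReal ((f (y + d) - f y) ^ 2)) +
          (ENNReal.ofReal η)⁻¹ * volume S := by
        rw [lintegral_add_left hm2, lintegral_indicator hSm, setLIntegral_const,
          lintegral_const_mul' _ _ ENNReal.ofReal_ne_top]
    _ ≤ _ := by
        refine add_le_add le_rfl (mul_le_mul' le_rfl ?_)
        calc volume S ≤ volume (boxN N L) + volume ((fun y => y + d) ⁻¹' boxN N L) :=
              measure_union_le _ _
          _ = volume (boxN N L) + volume (boxN N L) := by rw [measure_preimage_add_right]
          _ = 2 * volume (boxN N L) := (two_mul _).symm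

/-- The shift by `−d` has the same `L¹`-translation error as the shift by `d`. [folklore] -/
theorem lintegral_enorm_translate_neg_eq (f : Config N → ℝ) (d : Config N) :
    ∫⁻ y, ‖f (y + -d) - f y‖ₑ = ∫⁻ y, ‖f (y + d) - f y‖ₑ := by
  rw [← lintegral_add_right_eq_self (μ := (volume : Measure (Config N)))
    (fun y => ‖f (y + -d) - f y‖ₑ) d]
  refine lintegral_congr fun y => ?_
  rw [add_neg_cancel_right, enorm_sub_rev]

/-- The shift by `d₂ − d₁` costs at most the two shifts by `d₂` and `d₁`. [folklore] -/
theorem lintegral_enorm_translate_sub_sub_le {f : Config N → ℝ} (hf : Measurable f)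
    (d₁ d₂ : Config N) :
    ∫⁻ y, ‖f (y + (d₂ - d₁)) - f y‖ₑ ≤ (∫⁻ y, ‖f (y + d₂) - f y‖ₑ) + ∫⁻ y, ‖f (y + d₁) - f y‖ₑ := by
  rw [← lintegral_add_right_eq_self (μ := (volume : Measure (Config N)))
    (fun y => ‖f (y + (d₂ - d₁)) - f y‖ₑ) d₁,
    ← lintegral_add_left (f := fun y => ‖f (y + d₂) - f y‖ₑ)
      ((hf.comp (measurable_add_const d₂)).sub hf).enorm]
  refine lintegral_mono fun y => ?_
  have h1 : y + d₁ + (d₂ - d₁) = y + d₂ := by abel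
  rw [h1]
  calc ‖f (y + d₂) - f (y + d₁)‖ₑ = ‖(f (y + d₂) - f y) + (f y - f (y + d₁))‖ₑ := by
        rw [sub_add_sub_cancel]
    _ ≤ ‖f (y + d₂) - f y‖ₑ + ‖f y - f (y + d₁)‖ₑ := enorm_add_le _ _
    _ = _ := by rw [enorm_sub_rev (f y)]

/-- **Random shifts along the displacement**: for `f` vanishing off the box and `η > 0`,
`E ∫ |f(y + √2 b_s) − f(y)| dy ≤ η · sqIncr s f + η⁻¹ · 2|Λ_L^N|`. [folklore] -/
theorem lintegral_lintegral_enorm_translate_le_sqIncr {L : ℝ} {f : Config N → ℝ} (hf : Measurable f)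
    (h0 : ∀ X, X ∉ boxN N L → f X = 0) (s : ℝ≥0) {η : ℝ} (hη : 0 < η) :
    ∫⁻ ω, ∫⁻ y, ‖f (y + displacement s ω) - f y‖ₑ ∂volume ∂wienerPaths N ≤
      ENNReal.ofReal η * sqIncr s f + (ENNReal.ofReal η)⁻¹ * (2 * volume (boxN N L)) := by
  have hm : Measurable fun ω : PathSpace N =>
      ENNReal.ofReal η * ∫⁻ y, ENNReal.ofReal ((f (y + displacement s ω) - f y) ^ 2) :=
    (measurable_sqIncr_integrand hf s).lintegral_prod_right'.const_mul _
  calc ∫⁻ ω, ∫⁻ y, ‖f (y + displacement s ω) - f y‖ₑ ∂volume ∂wienerPaths N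
      ≤ ∫⁻ ω, (ENNReal.ofReal η * (∫⁻ y, ENNReal.ofReal ((f (y + displacement s ω) - f y) ^ 2)) +
          (ENNReal.ofReal η)⁻¹ * (2 * volume (boxN N L))) ∂wienerPaths N :=
        lintegral_mono fun ω => lintegral_enorm_translate_sub_le_eta hf h0 _ hη
    _ = _ := by
        rw [lintegral_add_left hm, lintegral_const, measure_univ, mul_one,
          lintegral_const_mul' _ _ ENNReal.ofReal_ne_top]
        rfl

/-- **The two translation errors of `interactionSlice_le` without continuity**: if
`sqIncr s f, sqIncr t f ≤ S`, then for every `η > 0` the errors of the shifts `−c_s` and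
`c_t − c_s` total at most `3 (η S + η⁻¹ · 2|Λ_L^N|)`. [folklore] -/
theorem translate_errors_le_three_mul {N : ℕ} {L : ℝ} {f : Config N → ℝ} (hf : Measurable f)
    (h0 : ∀ X, X ∉ boxN N L → f X = 0) {s t : ℝ≥0} {S : ℝ≥0∞} (hs : sqIncr s f ≤ S)
    (ht : sqIncr t f ≤ S) {η : ℝ} (hη : 0 < η) :
    (∫⁻ ω, ∫⁻ y, ‖f (y + -displacement s ω) - f y‖ₑ ∂volume ∂wienerPaths N) +
        ∫⁻ ω, ∫⁻ y, ‖f (y + (displacement t ω - displacement s ω)) - f y‖ₑ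
          ∂volume ∂wienerPaths N ≤
      3 * (ENNReal.ofReal η * S + (ENNReal.ofReal η)⁻¹ * (2 * volume (boxN N L))) := by
  set G : ℝ≥0∞ := ENNReal.ofReal η * S + (ENNReal.ofReal η)⁻¹ * (2 * volume (boxN N L)) with hG
  have hT : ∀ r : ℝ≥0, sqIncr r f ≤ S →
      ∫⁻ ω, ∫⁻ y, ‖f (y + displacement r ω) - f y‖ₑ ∂volume ∂wienerPaths N ≤ G := fun r hr =>
    (lintegral_lintegral_enorm_translate_le_sqIncr hf h0 r hη).trans (by rw [hG]; gcongr)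
  have h1 : (∫⁻ ω, ∫⁻ y, ‖f (y + -displacement s ω) - f y‖ₑ ∂volume ∂wienerPaths N) ≤ G := by
    calc (∫⁻ ω, ∫⁻ y, ‖f (y + -displacement s ω) - f y‖ₑ ∂volume ∂wienerPaths N)
        = ∫⁻ ω, ∫⁻ y, ‖f (y + displacement s ω) - f y‖ₑ ∂volume ∂wienerPaths N :=
          lintegral_congr fun ω => lintegral_enorm_translate_neg_eq f _
      _ ≤ G := hT s hs
  have hmt : Measurable fun ω : PathSpace N => ∫⁻ y, ‖f (y + displacement t ω) - f y‖ₑ :=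
    ((measurable_comp_add_displacement hf t).sub
      (hf.comp measurable_snd)).enorm.lintegral_prod_right'
  have h2 : (∫⁻ ω, ∫⁻ y, ‖f (y + (displacement t ω - displacement s ω)) - f y‖ₑ
      ∂volume ∂wienerPaths N) ≤ G + G := by
    calc (∫⁻ ω, ∫⁻ y, ‖f (y + (displacement t ω - displacement s ω)) - f y‖ₑ ∂volume ∂wienerPaths N)
        ≤ ∫⁻ ω, ((∫⁻ y, ‖f (y + displacement t ω) - f y‖ₑ) +
            ∫⁻ y, ‖f (y + displacement s ω) - f y‖ₑ) ∂wienerPaths N :=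
          lintegral_mono fun ω => lintegral_enorm_translate_sub_sub_le hf _ _
      _ = (∫⁻ ω, ∫⁻ y, ‖f (y + displacement t ω) - f y‖ₑ ∂volume ∂wienerPaths N) +
            ∫⁻ ω, ∫⁻ y, ‖f (y + displacement s ω) - f y‖ₑ ∂volume ∂wienerPaths N :=
          lintegral_add_left hmt _
      _ ≤ G + G := add_le_add (hT t ht) (hT s hs)
  calc _ ≤ G + (G + G) := add_le_add h1 h2
    _ = 3 * G := by ring

/-! ### Truncated potentials `min v k` -/

/-- The interaction is monotone in the pair profile. [folklore] -/
theorem interaction_mono_profile {v₁ v₂ : ℝ → ℝ≥0∞} (h : ∀ r, v₁ r ≤ v₂ r) (X : Config N) :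
    interaction v₁ X ≤ interaction v₂ X :=
  Finset.sum_le_sum fun _ _ => Finset.sum_le_sum fun _ _ => h _

/-- The action is monotone in the pair profile. [folklore] -/
theorem pathAction_mono_profile {v₁ v₂ : ℝ → ℝ≥0∞} (h : ∀ r, v₁ r ≤ v₂ r) (t : ℝ) (X : Config N)
    (ω : PathSpace N) : pathAction v₁ t X ω ≤ pathAction v₂ t X ω :=
  lintegral_mono fun _ => interaction_mono_profile h _

/-- Killing only decreases the weight: `w_t ≤ e^{-∫₀ᵗ V}`. [folklore] -/
theorem fkWeight_le_expNeg_pathAction (v : ℝ → ℝ≥0∞) (L t : ℝ) (X : Config N) (ω : PathSpace N) :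
    fkWeight v L t X ω ≤ expNeg (pathAction v t X ω) := by
  unfold fkWeight
  exact indicator_le_self' (fun _ _ => bot_le) ω

/-- **Truncation inside the weight defect**: for `v' ≤ v` with a finite action `a = ∫₀ᵗ V'(B_s) ds`,
`a ≤ (1 − w_t) + a²` in `[0, ∞]` (`w_t ≤ e^{−∫₀ᵗ V} ≤ e^{−a}` and `a ≤ 1 − e^{−a} + a²`).
[folklore] -/
theorem pathAction_le_one_sub_fkWeight_add_sq_of_le {v v' : ℝ → ℝ≥0∞} (h : ∀ r, v' r ≤ v r)
    (L t : ℝ) (X : Config N) (ω : PathSpace N) (htop : pathAction v' t X ω ≠ ⊤) :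
    pathAction v' t X ω ≤ (1 - fkWeight v L t X ω) + pathAction v' t X ω ^ 2 := by
  have hw : fkWeight v L t X ω ≤ expNeg (pathAction v' t X ω) :=
    (fkWeight_le_expNeg_pathAction v L t X ω).trans
      (expNeg_antitone (pathAction_mono_profile h t X ω))
  have hsub : 1 - expNeg (pathAction v' t X ω) ≤ 1 - fkWeight v L t X ω := tsub_le_tsub_left hw 1
  refine le_trans ?_ (add_le_add hsub le_rfl)
  set a : ℝ := (pathAction v' t X ω).toReal with ha
  have ha0 : 0 ≤ a := ENNReal.toReal_nonneg
  have hA : pathAction v' t X ω = ENNReal.ofReal a := (ENNReal.ofReal_toReal htop).symm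
  rw [expNeg, if_neg htop, hA, ENNReal.toReal_ofReal ha0]
  have h1 : (1 : ℝ≥0∞) - ENNReal.ofReal (Real.exp (-a)) = ENNReal.ofReal (1 - Real.exp (-a)) := by
    rw [← ENNReal.ofReal_one, ← ENNReal.ofReal_sub _ (Real.exp_nonneg _)]
  have h1' : 0 ≤ 1 - Real.exp (-a) := by
    have : Real.exp (-a) ≤ 1 := Real.exp_le_one_iff.2 (neg_nonpos.2 ha0)
    linarith
  rw [h1, ← ENNReal.ofReal_pow ha0, ← ENNReal.ofReal_add h1' (sq_nonneg _)]
  exact ENNReal.ofReal_le_ofReal (le_one_sub_exp_neg_add_sq ha0)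

/-- The truncated interactions `∑ min (v) k` increase with `k`. [folklore] -/
theorem monotone_interaction_min (v : ℝ → ℝ≥0∞) (X : Config N) :
    Monotone fun k : ℕ => interaction (fun r => min (v r) k) X :=
  fun _ _ hkl => interaction_mono_profile (fun _ => min_le_min_left _ (by exact_mod_cast hkl)) X

/-- The truncated interactions `∑ min (v) k` converge to `∑ v` as `k → ∞`. [folklore] -/
theorem tendsto_interaction_min (v : ℝ → ℝ≥0∞) (X : Config N) :
    Tendsto (fun k : ℕ => interaction (fun r => min (v r) k) X) atTop (𝓝 (interaction v X)) := by
  unfold interaction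
  refine tendsto_finsetSum _ fun i _ => tendsto_finsetSum _ fun j _ => ?_
  have h := (tendsto_const_nhds (x := v (dist (X i) (X j)))).min
    (ENNReal.tendsto_nat_nhds_top)
  simpa only [min_eq_left le_top] using h

/-- `∫ V_k |f|² → ∫ V |f|²` for the truncations `V_k = ∑ min (v) k` (monotone convergence).
[folklore] -/
theorem tendsto_lintegral_interaction_min {v : ℝ → ℝ≥0∞} (hv : Measurable v) {f : Config N → ℝ}
    (hf : Measurable f) :
    Tendsto (fun k : ℕ => ∫⁻ x, interaction (fun r => min (v r) k) x * ‖f x‖ₑ ^ 2) atTop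
      (𝓝 (∫⁻ x, interaction v x * ‖f x‖ₑ ^ 2)) := by
  refine lintegral_tendsto_of_tendsto_of_monotone (fun k => ?_) (Eventually.of_forall fun x => ?_)
    (Eventually.of_forall fun x => ?_)
  · exact ((measurable_interaction (hv.min measurable_const)).mul
      (hf.enorm.pow_const 2)).aemeasurable
  · exact fun k l hkl => mul_le_mul' (monotone_interaction_min v x hkl) le_rfl
  · exact ENNReal.Tendsto.mul_const (tendsto_interaction_min v x) (Or.inr (by simp))

end Summit.AtomisticToContinuum.BoseEinsteinCondensation.Theorems.CutLineWitness

end
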